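import Literature.NumberTheory.GelbartRogawski1991.FiniteAdelicWeilCentralCoinvariantsIsotypic
import Literature.NumberTheory.Automorphic.Liu2021.Def411WeilCarriersAtLine
import HarnessLib

/-!
# [Liu2021, Def. 4.11]'s `ω(μ, ε, χ) := ⊗'_v ω(μ_v, ε_v, χ_v)`: the CONSTRUCTED carriers `rho … ι ε χ` are LOCALLY ISOTYPIC

Topic `NumberTheory/Automorphic/Liu2021`.  KERNEL ONLY: theorems (no definition, no record, no named fact, no `sorry`).
Sequel of `GelbartRogawski1991/FiniteAdelicWeilCentralCoinvariantsIsotypic.lean` and local-isotypy twin of the `hirr` chain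
`Def411WeilCarriersIrreducibleOfReference → …OfLocal → …OfLemD1 → Def411IrreducibleOfLemD1AsPrinted`.

[Liu2021, Thm. 4.18 (2)] («mutually non-isomorphic», l. 2241) is proved by ONE sentence, «Statement (2) follows from Lemma D.1»
(l. 2270): from the LOCAL [App. D, Lem. D.1 (3)] through «`ω(μ, ε, χ) := ⊗'_v ω(μ_v, ε_v, χ_v)`» (Def. 4.11, l. 2092–2096).
The tree proves that passage over ABSTRACT local data (✔ `Literature.RepresentationTheory.Liu2021.eq_of_equiv` ∕ `chr_eq_of_equiv`,
✔ `Liu2021.hsep_of_lemD1AsPrinted` — the Δ2 bridge's cite leg `hsepW` ∕ `hμsep`) under ONE displayed input `hiso`: the global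
`ω(μ, ε, χ)` restricted to `U(V)(F_v)` is ISOTYPIC of type `ω(μ_v, ε_v, χ_v)`.  This file proves `hiso` for the tree's REAL
carriers `Def411WeilCarriers.rhoV ∕ rho … (hs) ε χ` (`Liu2021/Def411WeilCarriers.lean`: the `χ_W`-coinvariants of the finite
Weil representation of the pair `U(J_V) × U(⟨lineOf ε⟩)` through a compatible splitting family `s`), from EXACTLY the inputs
the END displays already feed ✔ `Def411WeilCarriers.rho_isIrreducible_of_lemD1AsPrinted` (local splittings `𝓢` with the
factorisation `hfac` of the displayed `μ`-splitting through the local reference section, the survival `hS` of the unramified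
vector, the irreducibility of the local quotient at `v` — [Liu2021, App. D Lem. D.1, first sentence]):

* §4 (a LINE `W`) `WeilCoinv.isotypicComponent_weilCoinv_comp_eq_top_of_omega_center` — from the `U(J_V)(𝔸_f)`-action on
  `Coinv(Ω ∘ (u ↦ u·1_n), χ'' ∘ (u ↦ u·1_W))` (§3 of the prequel) to `Ω(s, χ')` along three equivariant identifications: the
  `U(J_W)`-member of the pair IS the centre (✔ `finPairEmb_one_finAdelicCenter`), the local reference section realises
  `k ↦ Ω(reindex (k ⊗ 1))` up to `finSBReindex e` (✔ `finRepMp_localRefSection_apply`, `TwistedCoinv.mapEquiv`), and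
  ✔ `exists_weilCoinv_equiv_reference` (twist `χ(·, 1) = 1` on `U(J_V)(𝔸_f)`).
* §5 `Def411WeilCarriers.isotypicComponent_rhoV_comp_eq_top_of_twist`, `…_rho_comp_eq_top_of_twist`, and the `hfac` form
  **`Def411WeilCarriers.isotypicComponent_rho_comp_eq_top_of_factors`**: for EVERY finite place `v`, any restricted family
  `ψ_v : G'_v →* U(J_V ⊗ (lineOf ε))(F_v)` (the consumer's local groups, e.g. `U(J_V)(F_v)` via `k ↦ k ⊗ 1`) and any
  `φ' : G'_v →* G` over the coordinate embedding of `ψ_v` (`hsq`), the `ℂ[G'_v]`-module of `rho … ι ε χ ∘ φ'` is the sum of its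
  submodules isomorphic to `Coinv(ω_v ∘ (local centre), χ_v) ∘ ψ_v` — Mathlib `isotypicComponent … = ⊤`, the shape of `hiso`.

With `Lf v := LemD1OfPlace.family … (ω_v)` (✔ `Liu2021/LemD1FamilyOfPlace.lean`, `quotEquivRep`) this is the local-isotypy input
of ✔ `hsep_of_lemD1AsPrinted` for these carriers, so that the Δ2 junctions' `hsepW` ∕ `hμsep` follow from [Liu2021, Lem. D.1 (1),
(3)] AS PRINTED place by place; the remaining consumer-side data are the local embeddings `ψ_v` (`k ↦ k ⊗ 1`) with `hsq` and the
index bookkeeping `loc` ∕ `hpart`.  Nothing of [Liu2021] is asserted; HC_CM is NOT proved and not mentioned further; «Δ2 BRIDGE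
CLOSED» is NOT claimed.  Cell pub-hodgecm2 (COR-CM), Δ2 BRIDGE cite legs; seat prover-pub-hodgecm2-b10-g68-0.

## References
* [Liu2021] Y. Liu, Camb. J. Math. 9 (2021) = arXiv:2102.11518: Def. 4.11 (l. 2083–2097), App. D §D.1 Steps 1∕2∕3 (l. 5217∕
  5219∕5221), Lem. D.1 (l. 5227; (3) l. 5233), Thm. 4.18 (2) and its proof (l. 2241, 2270), App. C (l. 4624).
* [Flath1979] D. Flath, PSPM 33 (1979) part 1, §2 Ex. 2, Thm. 3 (uniqueness clause).
* [GelbartRogawski1991] S. Gelbart, J. Rogawski, Invent. Math. 105 (1991), §3.1 Prop. 3.1.1 p. 455 L1–3, Remark p. 457 L4–13.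
-/

set_option autoImplicit false

noncomputable section

open scoped MonoidAlgebra RestrictedProduct NumberField
open Filter Set IsDedekindDomain NumberField

namespace Literature.NumberTheory.GelbartRogawski1991.UnitaryDualPair.WeilCoinv

open scoped Kronecker Classical
open Literature.NumberTheory.Automorphic Literature.NumberTheory.Automorphic.UnitaryGroup
open Literature.NumberTheory.Weil1964 Literature.RepresentationTheory
open Literature.GroupTheory.RestrictedProductCharacter

variable (F E : Type) [Field F] [NumberField F] [Field E] [NumberField E] [Algebra F E]
variable (c : E ≃ₐ[F] E) (N : ℕ) {n : ℕ} (e : Fin N × Fin 1 ≃ Fin n)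
variable (JV : Matrix (Fin N) (Fin N) E) (JW : Matrix (Fin 1) (Fin 1) E)
variable {TV : Matrix (Fin N) (Fin N) F} {TW : Matrix (Fin 1) (Fin 1) F}
variable [Algebra.IsQuadraticExtension F E] {δ : E} (hcδ : c δ = -δ) (hδ : δ ≠ 0) {d : F}
  (hd : δ * δ = algebraMap F E d)

/-! ## §4 A LINE `W`: from `Coinv(Ω ∘ (u ↦ u·1_n), χ₁)` to `Ω(s, χ')` — equivariant identifications (reference section, twist `1` on `U(J_V)`) -/

section Chain

set_option maxHeartbeats 800000 in
/-- **`Ω(s, χ')` restricted along `τ : Γ →* U(J_V)(𝔸_f)` is `σ`-isotypic as soon as the `U(J_V)(𝔸_f)`-action on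
`Coinv(Ω ∘ (u ↦ u·1_n), χ'' ∘ (u ↦ u·1_W))` is** — provided the twist of `s` against the local reference section is trivial
on `U(J_V)(𝔸_f)` (`hχV : χ(k, 1) = 1`; automatic when `s` FACTORS through the reference section).  Links, each an
equivariant linear identification fed to §1: (B→C) the `U(J_W)`-member of the pair is the centre
(✔ `finPairEmb_one_finAdelicCenter`, `finAdelicCenter_surjective_one`; same relation submodule); (C→D) the reference section
`s₀ = localRefSection 𝓢` realises `k ↦ Ω(reindex (k ⊗ 1))` on `𝒮((𝔸_F^∞)^{N·1})` up to `finSBReindex e`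
(✔ `finRepMp_localRefSection_apply`, `TwistedCoinv.mapEquiv`); (D→E) ✔ `exists_weilCoinv_equiv_reference` with the twist
`χ(·, 1) = 1`.  The local-isotypy twin of ✔ `isIrreducible_weilCoinv_iff_omega_center`.
[cite: GelbartRogawski1991, §3.1 Remark p. 457 L4–13; Liu2021, Def. 4.11 (l. 2092–2096), App. D §D.1 Step 3 (l. 5221)] -/
theorem isotypicComponent_weilCoinv_comp_eq_top_of_omega_center (hV : TV.IsSymm) (hW : TW.IsSymm)
    (hVd : IsUnit TV.det) (hWd : IsUnit TW.det) (hJV : JV = TV.map (algebraMap F E)) (hJW : JW = TW.map (algebraMap F E))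
    (𝓢 : LocalSplitting.FinLocalSplittings F E c n hcδ hδ hd (gram F e TV TW) (isSymm_gram F e hV hW)
      (reindex_kronecker_eq_gram_map F E e hJV hJW))
    {s : UnitaryGroup.adelicPair F E c N 1 JV JW →* adelicMpCont F (Fin n) (adelicGram F e TV TW)}
    (hs : (splittingDatum F E c N 1 e JV JW hcδ hδ hd hV hW hVd hWd hJV hJW).IsCompatible s)
    {χ : UnitaryGroup.finAdelic F E c N JV × UnitaryGroup.finAdelic F E c 1 JW →* ℂˣ}
    (hχ : (pairSmall₁ F E c N 1 e JV JW s).comp (finPairToAdelic F E c N 1 JV JW) =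
      adelicMpCont.twist F (Fin N × Fin 1) _ (localRefSection F E c N 1 e JV JW hcδ hδ hd hV hW hJV hJW 𝓢) χ)
    {χ' χ'' : UnitaryGroup.finAdelic F E c 1 JW →* ℂˣ} (hχ' : ∀ u, χ' u = χ (1, u) * χ'' u)
    (hJW0 : JW 0 0 ≠ 0) (hχV : ∀ k, χ (k, 1) = 1)
    {Γ : Type*} [Group Γ] (τ : Γ →* UnitaryGroup.finAdelic F E c N JV)
    {Vσ : Type*} [AddCommGroup Vσ] [Module ℂ Vσ] (σ : Representation ℂ Γ Vσ) [σ.IsIrreducible]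
    (h : isotypicComponent ℂ[Γ]
      (Representation.asModule ((TwistedCoinv.rep (χ''.comp (UnitaryGroup.finAdelicCenter F E c 1 JW))
        (show Representation ℂ (UnitaryGroup.finAdelic F E c N JV) _ from
          𝓢.Omega.comp ((finPairEmb F E c N 1 e JV JW).comp (MonoidHom.inl _ _)))
        (commute_omega_finPairEmb_finAdelicCenter F E c N e JV JW hcδ hδ hd hV hW hJV hJW 𝓢)).comp τ))
      σ.asModule = ⊤) :
    isotypicComponent ℂ[Γ]
      (Representation.asModule ((weilCoinv F E c N 1 e JV JW hcδ hδ hd hV hW hVd hWd hJV hJW χ' hs).comp τ))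
      σ.asModule = ⊤ := by
  -- (B → C): the `U(J_W)`-member of the pair IS the centre; same relation submodule
  have hWrep : ∀ (u : UnitaryGroup.finAdelicOne F E c) (f : FinSB F (Fin n)),
      𝓢.Omega (finPairEmb F E c N 1 e JV JW (1, UnitaryGroup.finAdelicCenter F E c 1 JW u)) f =
        𝓢.Omega (UnitaryGroup.finAdelicCenter F E c n (Matrix.reindex e e (JV ⊗ₖ JW)) u) f := fun u f => by
    rw [finPairEmb_one_finAdelicCenter]
  have hkerBC : TwistedCoinv.ker (show Representation ℂ (UnitaryGroup.finAdelicOne F E c) _ from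
        𝓢.Omega.comp (UnitaryGroup.finAdelicCenter F E c n (Matrix.reindex e e (JV ⊗ₖ JW))))
        (χ''.comp (UnitaryGroup.finAdelicCenter F E c 1 JW)) =
      TwistedCoinv.ker (show Representation ℂ (UnitaryGroup.finAdelic F E c 1 JW) _ from
        𝓢.Omega.comp ((finPairEmb F E c N 1 e JV JW).comp (MonoidHom.inr _ _))) χ'' := by
    refine Eq.trans ?_ (TwistedCoinv.ker_comp_of_surjective
      (show Representation ℂ (UnitaryGroup.finAdelic F E c 1 JW) _ from
        𝓢.Omega.comp ((finPairEmb F E c N 1 e JV JW).comp (MonoidHom.inr _ _))) χ''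
      (UnitaryGroup.finAdelicCenter F E c 1 JW) (UnitaryGroup.finAdelicCenter_surjective_one F E c JW hJW0))
    exact TwistedCoinv.ker_eq_of_forall_smul (fun _ => 1)
      (fun u f => by rw [Units.val_one, one_smul]; exact (hWrep u f).symm) (fun u => by rw [one_mul])
  have hC := TwistedCoinv.isotypicComponent_rep_comp_eq_top_of_ker_eq _ _ _ _ hkerBC _
    (commute_omega_finPairEmb_finAdelicCenter F E c N e JV JW hcδ hδ hd hV hW hJV hJW 𝓢) _
    (commute_omega_finPairEmb F E c N 1 e JV JW hcδ hδ hd hV hW hJV hJW 𝓢) τ τ (fun _ => rfl) σ h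
  -- (C → D): the reference section realises `k ↦ Ω(reindex (k ⊗ 1))` up to `finSBReindex e`
  have hD := TwistedCoinv.isotypicComponent_rep_comp_eq_top_of_mapEquiv
    ((finRepMp (isUnit_kronecker_map F N hVd hWd) (localRefSection F E c N 1 e JV JW hcδ hδ hd hV hW hJV hJW 𝓢)
      (harch_reference F E c N 1 e JV JW hcδ hδ hd hV hW hVd hWd hJV hJW _
        (proj_localRefSection_eq F E c N 1 e JV JW hcδ hδ hd hV hW hVd hWd hJV hJW 𝓢 hs) hs)).comp (MonoidHom.inr _ _))
    χ''
    (show Representation ℂ (UnitaryGroup.finAdelic F E c 1 JW) _ from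
      𝓢.Omega.comp ((finPairEmb F E c N 1 e JV JW).comp (MonoidHom.inr _ _)))
    χ''
    ((finRepMp (isUnit_kronecker_map F N hVd hWd) (localRefSection F E c N 1 e JV JW hcδ hδ hd hV hW hJV hJW 𝓢)
      (harch_reference F E c N 1 e JV JW hcδ hδ hd hV hW hVd hWd hJV hJW _
        (proj_localRefSection_eq F E c N 1 e JV JW hcδ hδ hd hV hW hVd hWd hJV hJW 𝓢 hs) hs)).comp (MonoidHom.inl _ _))
    (show Representation ℂ (UnitaryGroup.finAdelic F E c N JV) _ from
      𝓢.Omega.comp ((finPairEmb F E c N 1 e JV JW).comp (MonoidHom.inl _ _)))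
    (commute_comp_inl_comp_inr _) (commute_omega_finPairEmb F E c N 1 e JV JW hcδ hδ hd hV hW hJV hJW 𝓢)
    (finSBReindex F e) (fun _ => 1) (fun u f => ?_) (fun u => (one_mul _).symm) (fun k f => ?_) τ σ hC
  rotate_left
  · -- `Ω(reindex (1 ⊗ u)) (R_e f) = R_e (ω_f^{s₀}(1, u) f)`
    rw [Units.val_one, one_smul]
    change 𝓢.Omega (finPairEmb F E c N 1 e JV JW (1, u)) (finSBReindex F e f) =
      finSBReindex F e (finRepMp (isUnit_kronecker_map F N hVd hWd) (localRefSection F E c N 1 e JV JW hcδ hδ hd hV hW hJV hJW 𝓢)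
        (harch_localRefSection F E c N 1 e JV JW hcδ hδ hd hV hW hVd hWd hJV hJW 𝓢 hs) (1, u) f)
    rw [finRepMp_localRefSection_apply F E c N 1 e JV JW hcδ hδ hd hV hW hVd hWd hJV hJW 𝓢 hs, LinearEquiv.apply_symm_apply]
  · -- `Ω(reindex (k ⊗ 1)) (R_e f) = R_e (ω_f^{s₀}(k, 1) f)`
    change 𝓢.Omega (finPairEmb F E c N 1 e JV JW (k, 1)) (finSBReindex F e f) =
      finSBReindex F e (finRepMp (isUnit_kronecker_map F N hVd hWd) (localRefSection F E c N 1 e JV JW hcδ hδ hd hV hW hJV hJW 𝓢)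
        (harch_localRefSection F E c N 1 e JV JW hcδ hδ hd hV hW hVd hWd hJV hJW 𝓢 hs) (k, 1) f)
    rw [finRepMp_localRefSection_apply F E c N 1 e JV JW hcδ hδ hd hV hW hVd hWd hJV hJW 𝓢 hs, LinearEquiv.apply_symm_apply]
  -- (D → E): `Ω(s, χ') ≅ Coinv(ω_f^{s₀}|_{U(J_W)}, χ'')`, equivariantly since `χ(·, 1) = 1`
  obtain ⟨T, -, hT⟩ :=
    exists_weilCoinv_equiv_reference F E c N 1 e JV JW hcδ hδ hd hV hW hVd hWd hJV hJW
      (proj_localRefSection_eq F E c N 1 e JV JW hcδ hδ hd hV hW hVd hWd hJV hJW 𝓢 hs) hχ hs hχ'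
  refine isotypicComponent_asModule_eq_top_of_surjective _ _ σ T.symm.toLinearMap (fun γ y => ?_) T.symm.surjective hD
  rw [LinearEquiv.coe_toLinearMap, LinearEquiv.symm_apply_eq, MonoidHom.comp_apply, MonoidHom.comp_apply, hT, hχV,
    Units.val_one, one_smul, LinearEquiv.apply_symm_apply]

end Chain

end Literature.NumberTheory.GelbartRogawski1991.UnitaryDualPair.WeilCoinv

/-! ## §5 [Liu2021, Def. 4.11]'s `ω(μ, ε, χ)` AT A REPRESENTATIVE LINE `⟨a⟩` (`rhoAtLine`) and at `lineOf ε` (`rho`): LOCAL ISOTYPY -/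

section Liu

open NumberField IsDedekindDomain
open scoped Kronecker Classical
open Literature.NumberTheory Literature.NumberTheory.Automorphic Literature.NumberTheory.Automorphic.UnitaryGroup
open Literature.NumberTheory.GelbartRogawski1991 Literature.NumberTheory.GelbartRogawski1991.UnitaryDualPair
open Literature.NumberTheory.GelbartRogawski1991.UnitaryDualPair.WeilCoinv
open Literature.NumberTheory.Weil1964 Literature.RepresentationTheory

namespace Literature.NumberTheory.Automorphic.Liu2021.Def411WeilCarriers

universe uG'

variable (F E : Type) [Field F] [NumberField F] [Field E] [NumberField E] [Algebra F E]
variable (c : E ≃ₐ[F] E) (N : ℕ) {n : ℕ} (e : Fin N × Fin 1 ≃ Fin n)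
variable (JV : Matrix (Fin N) (Fin N) E) {TV : Matrix (Fin N) (Fin N) F}
variable [Algebra.IsQuadraticExtension F E] {δ : E} (hcδ : c δ = -δ) (hδ : δ ≠ 0) {d : F} (hd : δ * δ = algebraMap F E d)
variable {G' : HeightOneSpectrum (𝓞 F) → Type uG'} [∀ v, Group (G' v)] {K' : ∀ v, Subgroup (G' v)}

/- DATA of §5 (explicit binders of every theorem): the pair data `(V, ⟨a⟩)` (`hV`, `hVd`, `hJV`), a compatible splitting family `s`
(`hs`), a representative line `a : Fˣ` (at the pin: `a = r ε`, `r` a faithful representative section; the tree's `rho … ε χ` is the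
instance `a := lineOf ε`, `rho_eq_rhoAtLine` rfl), the character `χ`; THE LOCAL DATA at `⟨a⟩`: local splittings `𝓢` of `U(J_V ⊗ (a))(F_v)`
(Liu's `ι_{μ_v}` for `V_{ε_v}`); THE TWIST, exposed (as in `Def411WeilCarriersAtLine` §3): `pairSmall₁ s_a ∘ finPairToAdelic = localRefSection 𝓢 ⊗ χtw`
(`hχtw`), `χ_W = χtw(1, ·) · χ''` (`hχ''`), `χ₁ = χ'' ∘ (u ↦ u·1_W)` (`hχ₁`); THE CONSUMER'S LOCAL GROUPS: a restricted family
`ψ_v : G'_v →* U(J_V ⊗ (a))(F_v)` (e.g. `U(J_V)(F_v)` via `k ↦ k ⊗ 1`, `UnitaryGroup.localLineInl`). -/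

/-- **[Liu2021, Def. 4.11]'s `ω(μ, ε, χ) := ⊗'_v ω(μ_v, ε_v, χ_v)` — LOCAL ISOTYPY of `rhoVAtLine … a χ`, the twist exposed.**
Let `s` be a compatible splitting family of the pair data `(V, ⟨a⟩)`, `𝓢` local splittings of `U(J_V ⊗ (a))(F_v)`, `χtw` the twist of
`s_a` against the local reference section of `𝓢` (`hχtw`), TRIVIAL ON `U(J_V)(𝔸_f)` (`hχtwV`), `χ_W = χtw(1, ·) · χ''` (`hχ''`),
`χ₁ = χ'' ∘ (u ↦ u·1_W)` continuous (`hχ₁`, `hχ₁c`), the class of `1_{𝒪_vⁿ}` at `χ_{1,v}` non-zero off a finite set (`hS` — Def. 4.11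
«unramified for all but finitely many `v`»).  Let `ψ_v : G'_v →* U(J_V ⊗ (a))(F_v)` be a restricted family and, at the place `v`,
`φloc : G'_v →* U(J_V)(𝔸_f)` with `finAdelicEquiv (reindex (φloc g ⊗ 1)) = Πʳψ (mulSingle v g)` (`hsq`).  IF the local quotient
`Coinv(ω_v ∘ (local centre), χ_{1,v})` pulled back along `ψ_v` is irreducible ([Liu2021, App. D Lem. D.1, first sentence], `hirr`), THEN
`rhoVAtLine … a χ` restricted along `φloc` is ISOTYPIC of that type: the `ℂ[G'_v]`-module is the sum of its submodules isomorphic to it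
(Mathlib `isotypicComponent … = ⊤`) — the input `hiso` of ✔ `Liu2021.hsep_of_lemD1AsPrinted` ∕ ✔ `Literature.RepresentationTheory.Liu2021.chr_eq_of_equiv`
for these carriers.  (§3 of the prequel + §4; `rhoVAtLine … a χ = weilCoinv (χ_W) (hs a)` by definition.)
[cite: Liu2021, Def. 4.11 (l. 2092–2096), App. D §D.1 Steps 1∕2∕3 (l. 5217∕5219∕5221), Lem. D.1 (l. 5227), Thm. 4.18 (2) with proof l. 2270; Flath1979, §2 Example 2 and Theorem 3 (uniqueness clause); GelbartRogawski1991, §3.1 Remark p. 457 L4–13] -/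
theorem isotypicComponent_rhoVAtLine_comp_eq_top_of_twist (hV : TV.IsSymm) (hVd : IsUnit TV.det)
    (hJV : JV = TV.map (algebraMap F E))
    {s : ∀ a : Fˣ, UnitaryGroup.adelicPair F E c N 1 JV (JW F E a) →* adelicMpCont F (Fin n) (adelicGram F e TV (TW F a))}
    (hs : ∀ a : Fˣ, (splittingDatum F E c N 1 e JV (JW F E a) hcδ hδ hd hV (isSymm_TW F a) hVd (isUnit_det_TW F a) hJV
      (JW_eq F E a)).IsCompatible (s a))
    (a : Fˣ) (χ : Chi F E c)
    (𝓢 : LocalSplitting.FinLocalSplittings F E c n hcδ hδ hd (gram F e TV (TW F a)) (isSymm_gram F e hV (isSymm_TW F a))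
      (reindex_kronecker_eq_gram_map F E e hJV (JW_eq F E a)))
    {χtw : UnitaryGroup.finAdelic F E c N JV × UnitaryGroup.finAdelic F E c 1 (JW F E a) →* ℂˣ}
    (hχtw : (pairSmall₁ F E c N 1 e JV (JW F E a) (s a)).comp (finPairToAdelic F E c N 1 JV (JW F E a)) =
      adelicMpCont.twist F (Fin N × Fin 1) _ (localRefSection F E c N 1 e JV (JW F E a) hcδ hδ hd hV (isSymm_TW F a) hJV (JW_eq F E a) 𝓢)
        χtw)
    {χ'' : UnitaryGroup.finAdelic F E c 1 (JW F E a) →* ℂˣ} (hχ'' : ∀ u, lineChar F E c a χ.1 u = χtw (1, u) * χ'' u)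
    {χ₁ : UnitaryGroup.finAdelicOne F E c →* ℂˣ} (hχ₁ : χ''.comp (UnitaryGroup.finAdelicCenter F E c 1 (JW F E a)) = χ₁)
    (ψ : ∀ v, G' v →* localPi E c n (Matrix.reindex e e (JV ⊗ₖ JW F E a)) v)
    (hψ : ∀ᶠ v in cofinite, MapsTo (ψ v) (K' v) (localInt E c n (Matrix.reindex e e (JV ⊗ₖ JW F E a)) v))
    (hχtwV : ∀ k, χtw (k, 1) = 1) (hχ₁c : Continuous χ₁)
    (hS : ∃ S₁ : Finset (HeightOneSpectrum (𝓞 F)), ∀ v ∉ S₁,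
      TwistedCoinv.mk (show Representation ℂ (UnitaryGroup.localPi E c 1 (JW F E a) v) _ from
          (𝓢.omegaLoc v).comp (localCenter E c n (Matrix.reindex e e (JV ⊗ₖ JW F E a)) (JW F E a) (JW_apply_ne_zero F E a) v))
        (localCharOfCenter F E c (JW F E a) (JW_apply_ne_zero F E a) χ₁ v) (unitVec F (Fin n) v) ≠ 0)
    (v : HeightOneSpectrum (𝓞 F))
    [hirr : (show Representation ℂ (G' v) _ from
      (TwistedCoinv.rep (localCharOfCenter F E c (JW F E a) (JW_apply_ne_zero F E a) χ₁ v) (𝓢.omegaLoc v)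
        (commute_omegaLoc_localCenter F E c N e JV (JW F E a) hcδ hδ hd hV (isSymm_TW F a) hJV (JW_eq F E a)
          (JW_apply_ne_zero F E a) 𝓢 v)).comp (ψ v)).IsIrreducible]
    (φloc : G' v →* UnitaryGroup.finAdelic F E c N JV)
    (hsq : ∀ g : G' v,
      finAdelicEquiv F E c n (Matrix.reindex e e (JV ⊗ₖ JW F E a)) (finPairEmb F E c N 1 e JV (JW F E a) (φloc g, 1)) =
        RestrictedProduct.mapAlongMonoidHom G' (fun v => localPi E c n (Matrix.reindex e e (JV ⊗ₖ JW F E a)) v) id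
          Filter.tendsto_id ψ hψ (mulSingleHom K' v g)) :
    isotypicComponent ℂ[G' v]
      (Representation.asModule ((rhoVAtLine F E c N e JV hcδ hδ hd hV hVd hJV hs a χ).comp φloc))
      (Representation.asModule (show Representation ℂ (G' v) _ from
        (TwistedCoinv.rep (localCharOfCenter F E c (JW F E a) (JW_apply_ne_zero F E a) χ₁ v) (𝓢.omegaLoc v)
          (commute_omegaLoc_localCenter F E c N e JV (JW F E a) hcδ hδ hd hV (isSymm_TW F a) hJV (JW_eq F E a)
            (JW_apply_ne_zero F E a) 𝓢 v)).comp (ψ v))) = ⊤ := by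
  subst hχ₁
  obtain ⟨S₁, hS₁⟩ := hS
  have hB := isotypicComponent_omega_center_comp_eq_top F E c N e JV (JW F E a) hcδ hδ hd hV (isSymm_TW F a) hJV (JW_eq F E a)
    (JW_apply_ne_zero F E a) 𝓢 ψ hψ hχ₁c hS₁ v φloc hsq
  exact isotypicComponent_weilCoinv_comp_eq_top_of_omega_center F E c N e JV (JW F E a) hcδ hδ hd hV (isSymm_TW F a) hVd
    (isUnit_det_TW F a) hJV (JW_eq F E a) 𝓢 (hs a) hχtw hχ'' (JW_apply_ne_zero F E a) hχtwV φloc _ hB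

/-- **The same for `rhoAtLine … ι a χ`** (the action of `𝔾(𝔸_F^∞) = G` through `ι : G →* U(J_V)(𝔸_f)`), restricted along any
`φ' : G'_v →* G` with `finAdelicEquiv (reindex (ι (φ' g) ⊗ 1)) = Πʳψ (mulSingle v g)`: `rhoAtLine ι a χ ∘ φ' = rhoVAtLine a χ ∘ (ι ∘ φ')`.
[cite: Liu2021, Def. 4.11 (l. 2092–2096), App. C (l. 4624), Thm. 4.18 (2) with proof l. 2270; Flath1979, Theorem 3 (uniqueness clause)] -/
theorem isotypicComponent_rhoAtLine_comp_eq_top_of_twist (hV : TV.IsSymm) (hVd : IsUnit TV.det)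
    (hJV : JV = TV.map (algebraMap F E))
    {s : ∀ a : Fˣ, UnitaryGroup.adelicPair F E c N 1 JV (JW F E a) →* adelicMpCont F (Fin n) (adelicGram F e TV (TW F a))}
    (hs : ∀ a : Fˣ, (splittingDatum F E c N 1 e JV (JW F E a) hcδ hδ hd hV (isSymm_TW F a) hVd (isUnit_det_TW F a) hJV
      (JW_eq F E a)).IsCompatible (s a))
    (a : Fˣ) (χ : Chi F E c)
    (𝓢 : LocalSplitting.FinLocalSplittings F E c n hcδ hδ hd (gram F e TV (TW F a)) (isSymm_gram F e hV (isSymm_TW F a))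
      (reindex_kronecker_eq_gram_map F E e hJV (JW_eq F E a)))
    {χtw : UnitaryGroup.finAdelic F E c N JV × UnitaryGroup.finAdelic F E c 1 (JW F E a) →* ℂˣ}
    (hχtw : (pairSmall₁ F E c N 1 e JV (JW F E a) (s a)).comp (finPairToAdelic F E c N 1 JV (JW F E a)) =
      adelicMpCont.twist F (Fin N × Fin 1) _ (localRefSection F E c N 1 e JV (JW F E a) hcδ hδ hd hV (isSymm_TW F a) hJV (JW_eq F E a) 𝓢)
        χtw)
    {χ'' : UnitaryGroup.finAdelic F E c 1 (JW F E a) →* ℂˣ} (hχ'' : ∀ u, lineChar F E c a χ.1 u = χtw (1, u) * χ'' u)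
    {χ₁ : UnitaryGroup.finAdelicOne F E c →* ℂˣ} (hχ₁ : χ''.comp (UnitaryGroup.finAdelicCenter F E c 1 (JW F E a)) = χ₁)
    (ψ : ∀ v, G' v →* localPi E c n (Matrix.reindex e e (JV ⊗ₖ JW F E a)) v)
    (hψ : ∀ᶠ v in cofinite, MapsTo (ψ v) (K' v) (localInt E c n (Matrix.reindex e e (JV ⊗ₖ JW F E a)) v))
    {G : Type*} [Group G] (ι : G →* UnitaryGroup.finAdelic F E c N JV)
    (hχtwV : ∀ k, χtw (k, 1) = 1) (hχ₁c : Continuous χ₁)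
    (hS : ∃ S₁ : Finset (HeightOneSpectrum (𝓞 F)), ∀ v ∉ S₁,
      TwistedCoinv.mk (show Representation ℂ (UnitaryGroup.localPi E c 1 (JW F E a) v) _ from
          (𝓢.omegaLoc v).comp (localCenter E c n (Matrix.reindex e e (JV ⊗ₖ JW F E a)) (JW F E a) (JW_apply_ne_zero F E a) v))
        (localCharOfCenter F E c (JW F E a) (JW_apply_ne_zero F E a) χ₁ v) (unitVec F (Fin n) v) ≠ 0)
    (v : HeightOneSpectrum (𝓞 F))
    [hirr : (show Representation ℂ (G' v) _ from
      (TwistedCoinv.rep (localCharOfCenter F E c (JW F E a) (JW_apply_ne_zero F E a) χ₁ v) (𝓢.omegaLoc v)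
        (commute_omegaLoc_localCenter F E c N e JV (JW F E a) hcδ hδ hd hV (isSymm_TW F a) hJV (JW_eq F E a)
          (JW_apply_ne_zero F E a) 𝓢 v)).comp (ψ v)).IsIrreducible]
    (φ' : G' v →* G)
    (hsq : ∀ g : G' v,
      finAdelicEquiv F E c n (Matrix.reindex e e (JV ⊗ₖ JW F E a)) (finPairEmb F E c N 1 e JV (JW F E a) (ι (φ' g), 1)) =
        RestrictedProduct.mapAlongMonoidHom G' (fun v => localPi E c n (Matrix.reindex e e (JV ⊗ₖ JW F E a)) v) id
          Filter.tendsto_id ψ hψ (mulSingleHom K' v g)) :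
    isotypicComponent ℂ[G' v]
      (Representation.asModule ((rhoAtLine F E c N e JV hcδ hδ hd hV hVd hJV hs ι a χ).comp φ'))
      (Representation.asModule (show Representation ℂ (G' v) _ from
        (TwistedCoinv.rep (localCharOfCenter F E c (JW F E a) (JW_apply_ne_zero F E a) χ₁ v) (𝓢.omegaLoc v)
          (commute_omegaLoc_localCenter F E c N e JV (JW F E a) hcδ hδ hd hV (isSymm_TW F a) hJV (JW_eq F E a)
            (JW_apply_ne_zero F E a) 𝓢 v)).comp (ψ v))) = ⊤ :=
  isotypicComponent_rhoVAtLine_comp_eq_top_of_twist F E c N e JV hcδ hδ hd hV hVd hJV hs a χ 𝓢 hχtw hχ'' hχ₁ ψ hψ hχtwV hχ₁c hS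
    v (ι.comp φ') hsq

/-- **LOCAL ISOTYPY of `ω(μ, ε, χ)` at the line `⟨a⟩` when the displayed splitting FACTORS through the local reference section**
(`χtw = 1`, hypothesis `hfac` — the local-global compatibility of the displayed `μ`-splitting with the local splittings `𝓢`, as in
✔ `rhoAtLine_isIrreducible_of_lemD1AsPrinted_of_factors`): the character of the centre is `χ` itself, and for EVERY finite place `v`,
along any `φ' : G'_v →* G` over the coordinate embedding of `ψ_v` (`hsq`), the `ℂ[G'_v]`-module of `rhoAtLine … ι a χ ∘ φ'` is the sum of
its submodules isomorphic to the local central `χ_v`-quotient of `ω_v` pulled back along `ψ_v` — provided the latter is irreducible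
([Liu2021, App. D Lem. D.1, first sentence]; e.g. ✔ `LemD1OfPlace.isIrreducible_rep_of_lemD1_1AsPrinted` from Lem. D.1 (1) AS PRINTED and
`n ≥ 3`, pulled back along a surjective `ψ_v`) and the unramified vector survives off a finite set (`hS`, ✔
`FinLocalSplittings.exists_finset_mk_unitVec_ne_zero`).  This is the binder `hiso` of ✔ `Liu2021.hsep_of_lemD1AsPrinted` (the Δ2 bridge's
`hsepW` ∕ `hμsep` cite leg) for the CONSTRUCTED carriers of [Liu2021, Def. 4.11].
[cite: Liu2021, Def. 4.11 (l. 2090–2096), App. D §D.1 Steps 1∕2∕3 (l. 5217∕5219∕5221), Lem. D.1 (l. 5227), Thm. 4.18 (2) with proof l. 2270; Flath1979, §2 Example 2 and Theorem 3 (uniqueness clause); GelbartRogawski1991, §3.1 Prop. 3.1.1 p. 455 L1–3] -/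
theorem isotypicComponent_rhoAtLine_comp_eq_top_of_factors (hV : TV.IsSymm) (hVd : IsUnit TV.det)
    (hJV : JV = TV.map (algebraMap F E))
    {s : ∀ a : Fˣ, UnitaryGroup.adelicPair F E c N 1 JV (JW F E a) →* adelicMpCont F (Fin n) (adelicGram F e TV (TW F a))}
    (hs : ∀ a : Fˣ, (splittingDatum F E c N 1 e JV (JW F E a) hcδ hδ hd hV (isSymm_TW F a) hVd (isUnit_det_TW F a) hJV
      (JW_eq F E a)).IsCompatible (s a))
    (a : Fˣ) (χ : Chi F E c)
    (𝓢 : LocalSplitting.FinLocalSplittings F E c n hcδ hδ hd (gram F e TV (TW F a)) (isSymm_gram F e hV (isSymm_TW F a))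
      (reindex_kronecker_eq_gram_map F E e hJV (JW_eq F E a)))
    (ψ : ∀ v, G' v →* localPi E c n (Matrix.reindex e e (JV ⊗ₖ JW F E a)) v)
    (hψ : ∀ᶠ v in cofinite, MapsTo (ψ v) (K' v) (localInt E c n (Matrix.reindex e e (JV ⊗ₖ JW F E a)) v))
    {G : Type*} [Group G] (ι : G →* UnitaryGroup.finAdelic F E c N JV)
    (hfac : (pairSmall₁ F E c N 1 e JV (JW F E a) (s a)).comp (finPairToAdelic F E c N 1 JV (JW F E a)) =
      localRefSection F E c N 1 e JV (JW F E a) hcδ hδ hd hV (isSymm_TW F a) hJV (JW_eq F E a) 𝓢)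
    (hS : ∃ S₁ : Finset (HeightOneSpectrum (𝓞 F)), ∀ v ∉ S₁,
      TwistedCoinv.mk (show Representation ℂ (UnitaryGroup.localPi E c 1 (JW F E a) v) _ from
          (𝓢.omegaLoc v).comp (localCenter E c n (Matrix.reindex e e (JV ⊗ₖ JW F E a)) (JW F E a) (JW_apply_ne_zero F E a) v))
        (localCharOfCenter F E c (JW F E a) (JW_apply_ne_zero F E a) χ.1 v) (unitVec F (Fin n) v) ≠ 0)
    (v : HeightOneSpectrum (𝓞 F))
    [hirr : (show Representation ℂ (G' v) _ from
      (TwistedCoinv.rep (localCharOfCenter F E c (JW F E a) (JW_apply_ne_zero F E a) χ.1 v) (𝓢.omegaLoc v)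
        (commute_omegaLoc_localCenter F E c N e JV (JW F E a) hcδ hδ hd hV (isSymm_TW F a) hJV (JW_eq F E a)
          (JW_apply_ne_zero F E a) 𝓢 v)).comp (ψ v)).IsIrreducible]
    (φ' : G' v →* G)
    (hsq : ∀ g : G' v,
      finAdelicEquiv F E c n (Matrix.reindex e e (JV ⊗ₖ JW F E a)) (finPairEmb F E c N 1 e JV (JW F E a) (ι (φ' g), 1)) =
        RestrictedProduct.mapAlongMonoidHom G' (fun v => localPi E c n (Matrix.reindex e e (JV ⊗ₖ JW F E a)) v) id
          Filter.tendsto_id ψ hψ (mulSingleHom K' v g)) :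
    isotypicComponent ℂ[G' v]
      (Representation.asModule ((rhoAtLine F E c N e JV hcδ hδ hd hV hVd hJV hs ι a χ).comp φ'))
      (Representation.asModule (show Representation ℂ (G' v) _ from
        (TwistedCoinv.rep (localCharOfCenter F E c (JW F E a) (JW_apply_ne_zero F E a) χ.1 v) (𝓢.omegaLoc v)
          (commute_omegaLoc_localCenter F E c N e JV (JW F E a) hcδ hδ hd hV (isSymm_TW F a) hJV (JW_eq F E a)
            (JW_apply_ne_zero F E a) 𝓢 v)).comp (ψ v))) = ⊤ :=
  isotypicComponent_rhoAtLine_comp_eq_top_of_twist F E c N e JV hcδ hδ hd hV hVd hJV hs a χ 𝓢 (χtw := 1)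
    (hfac.trans (MonoidHom.ext fun h => (adelicMpCont.twist_eq_of_eq_one _ (1 : _ →* ℂˣ) rfl).symm))
    (χ'' := lineChar F E c a χ.1) (fun u => by rw [MonoidHom.one_apply, one_mul])
    (MonoidHom.ext (lineChar_finAdelicCenter F E c a χ.1)) ψ hψ ι (fun _ => rfl) χ.2.1 hS v φ' hsq

/-- **LOCAL ISOTYPY of the tree's `rho … ι ε χ`** (the instance `a := lineOf ε` of the previous theorem: `rho_eq_rhoAtLine`, `rfl`),
under the factorisation `hfac` of the displayed splitting — EXACTLY the inputs of ✔ `rho_isIrreducible_of_lemD1AsPrinted_of_factors`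
plus the consumer's local embedding `ψ_v` with `hsq`.
[cite: Liu2021, Def. 4.11 (l. 2090–2096), App. D §D.1 Steps 1∕2∕3 (l. 5217∕5219∕5221), Lem. D.1 (l. 5227), Thm. 4.18 (2) with proof l. 2270; Flath1979, Theorem 3 (uniqueness clause)] -/
theorem isotypicComponent_rho_comp_eq_top_of_factors (hV : TV.IsSymm) (hVd : IsUnit TV.det)
    (hJV : JV = TV.map (algebraMap F E))
    {s : ∀ a : Fˣ, UnitaryGroup.adelicPair F E c N 1 JV (JW F E a) →* adelicMpCont F (Fin n) (adelicGram F e TV (TW F a))}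
    (hs : ∀ a : Fˣ, (splittingDatum F E c N 1 e JV (JW F E a) hcδ hδ hd hV (isSymm_TW F a) hVd (isUnit_det_TW F a) hJV
      (JW_eq F E a)).IsCompatible (s a))
    (ε : Eps F d) (χ : Chi F E c)
    (𝓢 : LocalSplitting.FinLocalSplittings F E c n hcδ hδ hd (gram F e TV (TW F (lineOf F d ε)))
      (isSymm_gram F e hV (isSymm_TW F (lineOf F d ε))) (reindex_kronecker_eq_gram_map F E e hJV (JW_eq F E (lineOf F d ε))))
    (ψ : ∀ v, G' v →* localPi E c n (Matrix.reindex e e (JV ⊗ₖ JW F E (lineOf F d ε))) v)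
    (hψ : ∀ᶠ v in cofinite, MapsTo (ψ v) (K' v) (localInt E c n (Matrix.reindex e e (JV ⊗ₖ JW F E (lineOf F d ε))) v))
    {G : Type*} [Group G] (ι : G →* UnitaryGroup.finAdelic F E c N JV)
    (hfac : (pairSmall₁ F E c N 1 e JV (JW F E (lineOf F d ε)) (s (lineOf F d ε))).comp
        (finPairToAdelic F E c N 1 JV (JW F E (lineOf F d ε))) =
      localRefSection F E c N 1 e JV (JW F E (lineOf F d ε)) hcδ hδ hd hV (isSymm_TW F _) hJV (JW_eq F E _) 𝓢)
    (hS : ∃ S₁ : Finset (HeightOneSpectrum (𝓞 F)), ∀ v ∉ S₁,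
      TwistedCoinv.mk (show Representation ℂ (UnitaryGroup.localPi E c 1 (JW F E (lineOf F d ε)) v) _ from
          (𝓢.omegaLoc v).comp (localCenter E c n (Matrix.reindex e e (JV ⊗ₖ JW F E (lineOf F d ε))) (JW F E (lineOf F d ε))
            (JW_apply_ne_zero F E _) v))
        (localCharOfCenter F E c (JW F E (lineOf F d ε)) (JW_apply_ne_zero F E _) χ.1 v) (unitVec F (Fin n) v) ≠ 0)
    (v : HeightOneSpectrum (𝓞 F))
    [hirr : (show Representation ℂ (G' v) _ from
      (TwistedCoinv.rep (localCharOfCenter F E c (JW F E (lineOf F d ε)) (JW_apply_ne_zero F E _) χ.1 v) (𝓢.omegaLoc v)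
        (commute_omegaLoc_localCenter F E c N e JV (JW F E (lineOf F d ε)) hcδ hδ hd hV (isSymm_TW F _) hJV
          (JW_eq F E _) (JW_apply_ne_zero F E _) 𝓢 v)).comp (ψ v)).IsIrreducible]
    (φ' : G' v →* G)
    (hsq : ∀ g : G' v,
      finAdelicEquiv F E c n (Matrix.reindex e e (JV ⊗ₖ JW F E (lineOf F d ε)))
          (finPairEmb F E c N 1 e JV (JW F E (lineOf F d ε)) (ι (φ' g), 1)) =
        RestrictedProduct.mapAlongMonoidHom G' (fun v => localPi E c n (Matrix.reindex e e (JV ⊗ₖ JW F E (lineOf F d ε))) v)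
          id Filter.tendsto_id ψ hψ (mulSingleHom K' v g)) :
    isotypicComponent ℂ[G' v]
      (Representation.asModule ((rho F E c N e JV hcδ hδ hd hV hVd hJV hs ι ε χ).comp φ'))
      (Representation.asModule (show Representation ℂ (G' v) _ from
        (TwistedCoinv.rep (localCharOfCenter F E c (JW F E (lineOf F d ε)) (JW_apply_ne_zero F E _) χ.1 v) (𝓢.omegaLoc v)
          (commute_omegaLoc_localCenter F E c N e JV (JW F E (lineOf F d ε)) hcδ hδ hd hV (isSymm_TW F _) hJV
            (JW_eq F E _) (JW_apply_ne_zero F E _) 𝓢 v)).comp (ψ v))) = ⊤ :=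
  isotypicComponent_rhoAtLine_comp_eq_top_of_factors F E c N e JV hcδ hδ hd hV hVd hJV hs (lineOf F d ε) χ 𝓢 ψ hψ ι hfac hS v φ'
    hsq

end Literature.NumberTheory.Automorphic.Liu2021.Def411WeilCarriers

end Liu

end
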